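import Literature.NumberTheory.EllipticCurves.Kato2004.Condition1252
import Mathlib.LinearAlgebra.Matrix.Transvection
import HarnessLib

/-!
# Kato's (12.5.2) / the `p`-adic tower from ONE non-scalar first-order witness — no trace
# hypothesis (odd `p`)

`Proofs` file (theorems only: no definition, no named fact, debt 0), topic
`NumberTheory/EllipticCurves`, companion of `Kato2004/Condition1252.lean` (cell `bsd-rank1-residual`,
unit `b2b-bsdres-lit-kato`, gen 8).

`Condition1252.lean` proves (gen 6, `WeierstrassCurve.forall_hasSurjectiveModNGaloisRep_of_firstOrderWitness`):
for an elliptic curve `E = W/ℚ`, an odd prime `p` with `ρ̄_{E,p}` onto `GL₂(𝔽_p)`, and ONE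
`τ ∈ Γ_ℚ` acting on `T_pE` as `1 + p M₀ + p² V` with `M₀` non-scalar modulo `p` AND `tr M₀ ∈ ℤ_pˣ`,
every `ρ̄_{E,p^n}` is onto (`ρ_{E,p^∞}(Γ_ℚ) = GL₂(ℤ_p)`, Kato's (12.5.2)).  This file REMOVES the
trace hypothesis:

* `WeierstrassCurve.exists_firstOrder_isUnit_trace` — for `p` odd and `ρ̄_{E,p}` onto there is ALWAYS
  a `τ` acting as `1 + p M + p² V` with `tr M ∈ ℤ_pˣ` (equivalently `χ_p(τ) ≢ 1 (mod p²)` while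
  `ρ̄_{E,p}(τ) = 1`).  Proof: otherwise `χ_p mod p²` would be a multiplicative class function of
  `ρ̄_{E,p}(σ) ∈ GL₂(𝔽_p)` (`det ρ_{E,p} = χ_p`, `det(1 + pM) ≡ 1 + p tr M`); but a homomorphism
  from `GL₂(𝔽_p)` to a commutative group kills `g^{2(p-1)}` — `GL₂(𝔽_p)` is generated by
  transvections `T` and invertible diagonal matrices `D` (Mathlib
  `Matrix.diagonal_transvection_induction_of_det_ne_zero`), `D^{p-1} = 1`, and
  `T⁻² = T⁻¹ · d T d⁻¹` (`d = diag(1,-1)`) is a commutator — whereas `χ_p` is onto `ℤ_pˣ`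
  (`GaloisRep.cyclotomicCharacter_surjective`) and `(1+p)^{2(p-1)} ≡ 1 - 2p ≢ 1 (mod p²)`.
  (I.e. `GL₂(𝔽_p)` has no quotient of order `p`: the determinant step of Serre's lifting lemma,
  *Abelian `ℓ`-adic representations* IV-23; Lang, *Elliptic Functions*, Ch. 17 §4.)
* `WeierstrassCurve.forall_hasSurjectiveModNGaloisRep_of_firstOrderWitness_of_nonscalar` — surj(`p`),
  `p` odd, one first-order witness non-scalar mod `p` ⟹ the whole tower; and
  `Kato2004.imageContainsSL2_of_firstOrderWitness_of_nonscalar` ((12.5.2)).  If the unit-trace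
  element `S` is scalar mod `p`, `S + M₀` is a witness of the old kind.

Use (cell `bsd-rank1-residual`): the good-SUPERSINGULAR case of Wuthrich 2014 Lemma 20 at `p = 3`
(`Wuthrich2014/ThreeAdicImage.lean`), where the inertia group at `3` supplies a kernel element of
`ρ̄_{E,9} → ρ̄_{E,3}` that is non-scalar but of unknown trace; and the per-pair Frobenius
certificates of `Kato2004/ThreeAdicFrobeniusCertificate.lean`, which no longer need a unit trace.

The small private helpers `firstOrder_add`, `isUnit_add_of_dvd`, `dvd_of_not_isUnit`,
`isUnit_one_add_p_mul`, `toMatrix_galoisRepTate_mul`, `mat_one_add_mul_one_add` are copies of the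
private lemmas of the same names in `Condition1252.lean` (same statements and proofs).

## References

* [SerreAbelianLadic1968] J.-P. Serre, *Abelian `ℓ`-adic representations and elliptic curves*
  (1968), Ch. IV §3.4, Lemma 3 (IV-23) and its proof.
* [Lang1987] S. Lang, *Elliptic Functions*, 2nd ed. (1987), Ch. 17 §4 (pp. 178–179).
* [SilvermanAEC2009] J. H. Silverman, *AEC*, 2nd ed. (2009), Prop. III.8.1, III.8.3 (`det = χ_p`).
* [Kato2004Asterisque] K. Kato, Astérisque 295 (2004), (12.5.2) in Thm. 12.5 (4) (p. 222).
* [Elkies2006] N. D. Elkies, arXiv:math/0612734, Introduction and §1 (the `3`-adic exception).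
-/

noncomputable section

open scoped Classical
open Field

namespace WeierstrassCurve

open Literature.NumberTheory.EllipticCurves Literature.NumberTheory.GaloisRepresentations

variable (W : WeierstrassCurve ℚ) (p : ℕ) [Fact p.Prime]

section Copies

/-! ### Private copies of helpers of `Condition1252.lean` -/

variable (b : Module.Basis (Fin 2) ℤ_[p] (W.tateModule p))

/-- Matrices of `ρ` are multiplicative. [folklore] -/
private theorem toMatrix_galoisRepTate_mul (σ τ : absoluteGaloisGroup ℚ) :
    LinearMap.toMatrix b b (W.galoisRepTate p (σ * τ)) =
      LinearMap.toMatrix b b (W.galoisRepTate p σ) * LinearMap.toMatrix b b (W.galoisRepTate p τ) := by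
  rw [map_mul, LinearMap.toMatrix_mul]

variable {W p b}

/-- Product of two first-order expansions, `2 × 2` matrices over a commutative ring. [folklore] -/
private theorem mat_one_add_mul_one_add {R : Type*} [CommRing R] (a : R) (M₁ M₂ V₁ V₂ : Matrix (Fin 2) (Fin 2) R) :
    (1 + a • M₁ + a ^ 2 • V₁) * (1 + a • M₂ + a ^ 2 • V₂) =
      1 + a • (M₁ + M₂) +
        a ^ 2 • (V₁ + V₂ + M₁ * M₂ + a • (M₁ * V₂ + V₁ * M₂) + a ^ 2 • (V₁ * V₂)) := by
  ext i j
  fin_cases i <;> fin_cases j <;>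
    simp [Matrix.mul_apply, Fin.sum_univ_two, Matrix.add_apply, Matrix.smul_apply,
      Matrix.one_apply] <;> ring

/-- First-order kernel elements are closed under addition (`τ₁ τ₂`). [folklore] -/
private theorem firstOrder_add {M₁ M₂ : Matrix (Fin 2) (Fin 2) ℤ_[p]}
    (h₁ : ∃ (τ : absoluteGaloisGroup ℚ) (V : Matrix (Fin 2) (Fin 2) ℤ_[p]),
      LinearMap.toMatrix b b (W.galoisRepTate p τ) = 1 + (p : ℤ_[p]) • M₁ + ((p : ℤ_[p]) ^ 2) • V)
    (h₂ : ∃ (τ : absoluteGaloisGroup ℚ) (V : Matrix (Fin 2) (Fin 2) ℤ_[p]),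
      LinearMap.toMatrix b b (W.galoisRepTate p τ) = 1 + (p : ℤ_[p]) • M₂ + ((p : ℤ_[p]) ^ 2) • V) :
    ∃ (τ : absoluteGaloisGroup ℚ) (V : Matrix (Fin 2) (Fin 2) ℤ_[p]),
      LinearMap.toMatrix b b (W.galoisRepTate p τ) =
        1 + (p : ℤ_[p]) • (M₁ + M₂) + ((p : ℤ_[p]) ^ 2) • V := by
  obtain ⟨τ₁, V₁, h₁⟩ := h₁
  obtain ⟨τ₂, V₂, h₂⟩ := h₂
  refine ⟨τ₁ * τ₂, V₁ + V₂ + M₁ * M₂ + (p : ℤ_[p]) • (M₁ * V₂ + V₁ * M₂) +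
    ((p : ℤ_[p]) ^ 2) • (V₁ * V₂), ?_⟩
  rw [toMatrix_galoisRepTate_mul, h₁, h₂, mat_one_add_mul_one_add]

/-- In `ℤ_p`, `1 + p z` is a unit. [folklore] -/
private theorem isUnit_one_add_p_mul (z : ℤ_[p]) : IsUnit (1 + (p : ℤ_[p]) * z) := by
  have hp : p.Prime := Fact.out
  have hmem : -((p : ℤ_[p]) * z) ∈ nonunits ℤ_[p] := by
    rw [PadicInt.mem_nonunits, norm_neg, norm_mul, PadicInt.norm_p]
    have hz : ‖z‖ ≤ 1 := PadicInt.norm_le_one z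
    have hp1 : ((p : ℝ))⁻¹ < 1 := inv_lt_one_of_one_lt₀ (by exact_mod_cast hp.one_lt)
    have hp2 : (0 : ℝ) < ((p : ℝ))⁻¹ := inv_pos.mpr (by exact_mod_cast hp.pos)
    nlinarith [norm_nonneg z]
  have h := IsLocalRing.isUnit_one_sub_self_of_mem_nonunits _ hmem
  rwa [sub_neg_eq_add] at h

/-- A unit plus a multiple of `p` is a unit (`ℤ_p` is local). [folklore] -/
private theorem isUnit_add_of_dvd {u z : ℤ_[p]} (hu : IsUnit u) (hz : (p : ℤ_[p]) ∣ z) :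
    IsUnit (u + z) := by
  obtain ⟨y, rfl⟩ := hz
  obtain ⟨v, rfl⟩ := hu
  have h : (v : ℤ_[p]) * (1 + (p : ℤ_[p]) * (↑v⁻¹ * y)) = v + (p : ℤ_[p]) * y := by
    rw [mul_add, mul_one, mul_left_comm, Units.mul_inv_cancel_left]
  rw [← h]
  exact (Units.isUnit v).mul (isUnit_one_add_p_mul _)

/-- A non-unit of `ℤ_p` is divisible by `p`. [folklore] -/
private theorem dvd_of_not_isUnit {z : ℤ_[p]} (hz : ¬ IsUnit z) : (p : ℤ_[p]) ∣ z := by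
  rw [PadicInt.isUnit_iff] at hz
  exact (PadicInt.norm_lt_one_iff_dvd z).mp (lt_of_le_of_ne (PadicInt.norm_le_one z) hz)

end Copies

/-! ### A first-order kernel element with unit trace always exists; the witness theorem without trace -/

section FirstOrderNoTrace

variable {W p}
variable {b : Module.Basis (Fin 2) ℤ_[p] (W.tateModule p)}

/-- In `M₂` over a commutative ring: `diag(1,-1) · T · diag(1,-1) = T⁻¹` for a transvection `T`
(`2 × 2` transvections are `(1 c; 0 1)` or `(1 0; c 1)`). [folklore] -/
private theorem mat_diag_transvection_diag {R : Type*} [CommRing R]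
    (t : Matrix.TransvectionStruct (Fin 2) R) :
    !![(1 : R), 0; 0, -1] * t.toMatrix * !![(1 : R), 0; 0, -1] = t.inv.toMatrix := by
  obtain ⟨i, j, hij, c⟩ := t
  simp only [Matrix.TransvectionStruct.inv, Matrix.TransvectionStruct.toMatrix_mk,
    Matrix.transvection]
  ext a b'
  simp only [Matrix.mul_apply, Fin.sum_univ_two, Matrix.add_apply, Matrix.one_apply,
    Matrix.single, Matrix.of_apply, Matrix.cons_val', Matrix.cons_val_zero, Matrix.cons_val_one,
    Matrix.empty_val', Matrix.cons_val_fin_one]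
  fin_cases i <;> fin_cases j
  · exact absurd rfl hij
  · fin_cases a <;> fin_cases b' <;> simp
  · fin_cases a <;> fin_cases b' <;> simp
  · exact absurd rfl hij

/-- `diag(1,-1)² = 1`. [folklore] -/
private theorem mat_diag_mul_diag {R : Type*} [CommRing R] :
    !![(1 : R), 0; 0, -1] * !![(1 : R), 0; 0, -1] = 1 := by
  ext i j
  fin_cases i <;> fin_cases j <;> simp [Matrix.mul_apply, Fin.sum_univ_two]

/-- A matrix `≡ 1 (mod p)` is `1 + p Y`. [folklore] -/
private theorem exists_eq_one_add_p_smul_of_mapMatrix_eq_one {A : Matrix (Fin 2) (Fin 2) ℤ_[p]}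
    (hA : (PadicInt.toZMod (p := p)).mapMatrix A = 1) :
    ∃ Y : Matrix (Fin 2) (Fin 2) ℤ_[p], A = 1 + (p : ℤ_[p]) • Y := by
  have h0 : (PadicInt.toZMod (p := p)).mapMatrix (A - 1) = 0 := by
    rw [map_sub, hA, map_one, sub_self]
  have h : ∀ i j, ∃ y : ℤ_[p], (A - 1) i j = (p : ℤ_[p]) * y := by
    intro i j
    have h1 : PadicInt.toZMod ((A - 1) i j) = 0 := by
      have := congrFun (congrFun h0 i) j
      rwa [RingHom.mapMatrix_apply, Matrix.map_apply] at this
    have h2 : (A - 1) i j ∈ RingHom.ker (PadicInt.toZMod (p := p)) := h1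
    rw [PadicInt.ker_toZMod, PadicInt.maximalIdeal_eq_span_p, Ideal.mem_span_singleton] at h2
    exact h2
  choose y hy using h
  refine ⟨Matrix.of fun i j => y i j, ?_⟩
  ext i j
  have := hy i j
  rw [Matrix.sub_apply, sub_eq_iff_eq_add'] at this
  rw [this, Matrix.add_apply, Matrix.smul_apply, Matrix.of_apply, smul_eq_mul]

/-- Every invertible matrix modulo `p` is the reduction of the matrix of some `ρ(σ)`, when
`ρ̄_{E,p}` is onto (lift the entries to `ℤ_p`; the lift has unit determinant; apply (a) at level
`p`). [folklore] -/
private theorem exists_mapMatrix_toMatrix_galoisRepTate_eq [W.IsElliptic]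
    (h1 : W.HasSurjectiveModNGaloisRep p) (M : Matrix (Fin 2) (Fin 2) (ZMod p)) (hM : M.det ≠ 0) :
    ∃ σ : absoluteGaloisGroup ℚ,
      (PadicInt.toZMod (p := p)).mapMatrix (LinearMap.toMatrix b b (W.galoisRepTate p σ)) = M := by
  have hp : p.Prime := Fact.out
  have hlift : ∀ i j, ∃ x : ℤ_[p], PadicInt.toZMod x = M i j := fun i j =>
    ZMod.ringHom_surjective _ _
  choose x hx using hlift
  set Mt : Matrix (Fin 2) (Fin 2) ℤ_[p] := Matrix.of fun i j => x i j with hMt_def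
  have hMt : (PadicInt.toZMod (p := p)).mapMatrix Mt = M := by
    ext i j
    rw [RingHom.mapMatrix_apply, Matrix.map_apply, hMt_def, Matrix.of_apply, hx]
  have hdet : IsUnit Mt.det := by
    have h : PadicInt.toZMod Mt.det = M.det := by rw [RingHom.map_det, hMt]
    by_contra hu
    have hmem : Mt.det ∈ IsLocalRing.maximalIdeal ℤ_[p] := hu
    rw [← PadicInt.ker_toZMod, RingHom.mem_ker, h] at hmem
    exact hM hmem
  have hB : IsUnit (LinearMap.det (Matrix.toLin b b Mt)) := by rwa [LinearMap.det_toLin]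
  have h1' : W.HasSurjectiveModNGaloisRep (p ^ 1 : ℕ) := by rwa [pow_one]
  obtain ⟨σ, C, hσ⟩ := exists_galoisRepTate_eq_add_smul_of_hasSurjectiveModNGaloisRep W p h1'
    (Matrix.toLin b b Mt) hB
  refine ⟨σ, ?_⟩
  rw [hσ, map_add, map_smul, LinearMap.toMatrix_toLin, pow_one, map_add, hMt, add_eq_left]
  ext i j
  rw [RingHom.mapMatrix_apply, Matrix.map_apply, Matrix.smul_apply, smul_eq_mul, map_mul,
    map_natCast, ZMod.natCast_self, zero_mul, Matrix.zero_apply]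

/-- `(1 + x)^m = 1 + m x` when `x² = 0`. [folklore] -/
private theorem one_add_pow_of_sq_eq_zero {R : Type*} [CommRing R] {x : R} (hx : x ^ 2 = 0) (m : ℕ) :
    (1 + x) ^ m = 1 + (m : R) * x := by
  induction m with
  | zero => simp
  | succ m ih =>
    rw [pow_succ, ih, Nat.cast_succ]
    have : x * x = 0 := by rw [← sq, hx]
    linear_combination (m : R) * this

set_option maxHeartbeats 800000 in
/-- **A first-order kernel element with UNIT TRACE always exists** (`p` odd, `ρ̄_{E,p}` onto).
There is `τ ∈ Γ_ℚ` acting on `T_pE` (in the basis `b`) as `1 + p M + p² V` with `tr M ∈ ℤ_pˣ`,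
equivalently with `χ_p(τ) = det ρ(τ) ≢ 1 (mod p²)`.  Proof.  Suppose not: then every `σ` with
`ρ(σ) ≡ 1 (mod p)` has `χ_p(σ) ≡ 1 (mod p²)` (`det(1 + pM) ≡ 1 + p·tr M`), so `χ_p mod p²` is a
class function of `ρ̄_{E,p}(σ) ∈ GL₂(𝔽_p)`, multiplicative.  A homomorphism from `GL₂(𝔽_p)` to a
commutative group kills `g^{2(p-1)}` for every `g`: `GL₂(𝔽_p)` is generated by transvections `T`
and invertible diagonal matrices `D` (Mathlib `Matrix.diagonal_transvection_induction_of_det_ne_zero`),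
`D^{p-1} = 1`, and `T⁻² = T⁻¹ d T d⁻¹` with `d = diag(1,-1)` is a commutator.  Hence
`χ_p(σ)^{2(p-1)} ≡ 1 (mod p²)` for all `σ`; but `χ_p` is onto `ℤ_pˣ`
(`GaloisRep.cyclotomicCharacter_surjective`) and `(1+p)^{2(p-1)} ≡ 1 - 2p ≢ 1 (mod p²)` for
`p` odd.  (Equivalently: `GL₂(𝔽_p)` has no quotient of order `p`, its abelianisation being
`𝔽_pˣ` via `det` — Serre 1968 IV-23 / Lang, *Elliptic Functions*, Ch. 17 §4, the determinant step
of the lifting lemma; `det ρ_{E,p} = χ_p`, Silverman *AEC* III.8.)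
[cite: SerreAbelianLadic1968, Ch. IV §3.4, Lemma 3 (IV-23), proof]
[cite: SilvermanAEC2009, Prop. III.8.1 and Prop. III.8.3] -/
theorem exists_firstOrder_isUnit_trace [W.IsElliptic] (hp2 : p ≠ 2)
    (h1 : W.HasSurjectiveModNGaloisRep p) (b : Module.Basis (Fin 2) ℤ_[p] (W.tateModule p)) :
    ∃ M : Matrix (Fin 2) (Fin 2) ℤ_[p], IsUnit M.trace ∧
      ∃ (τ : absoluteGaloisGroup ℚ) (V : Matrix (Fin 2) (Fin 2) ℤ_[p]),
        LinearMap.toMatrix b b (W.galoisRepTate p τ) = 1 + (p : ℤ_[p]) • M + ((p : ℤ_[p]) ^ 2) • V := by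
  have hp : p.Prime := Fact.out
  have hp0 : (p : ℚ) ≠ 0 := Nat.cast_ne_zero.mpr hp.ne_zero
  by_contra hcon
  push Not at hcon
  -- notation: `ρb σ` = the matrix of `ρ(σ)` modulo `p`; `χ2 σ` = `χ_p(σ) mod p²`
  set r : Matrix (Fin 2) (Fin 2) ℤ_[p] →+* Matrix (Fin 2) (Fin 2) (ZMod p) :=
    (PadicInt.toZMod (p := p)).mapMatrix with hr
  set ρ := W.galoisRepTate p with hρ
  set ρb : absoluteGaloisGroup ℚ → Matrix (Fin 2) (Fin 2) (ZMod p) :=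
    fun σ ↦ r (LinearMap.toMatrix b b (ρ σ)) with hρb
  set χ := GaloisRep.cyclotomicCharacter ℚ p with hχ
  set χ2 : absoluteGaloisGroup ℚ → ZMod (p ^ 2) :=
    fun σ ↦ PadicInt.toZModPow 2 ((χ σ : ℤ_[p]ˣ) : ℤ_[p]) with hχ2
  have hρb_mul : ∀ σ τ, ρb (σ * τ) = ρb σ * ρb τ := fun σ τ ↦ by
    simp only [hρb]; rw [toMatrix_galoisRepTate_mul, map_mul]
  have hρb_one : ρb 1 = 1 := by
    simp only [hρb]; rw [map_one, LinearMap.toMatrix_one, map_one]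
  have hρb_inv_mul : ∀ σ, ρb σ⁻¹ * ρb σ = 1 := fun σ ↦ by
    rw [← hρb_mul, inv_mul_cancel, hρb_one]
  have hρb_mul_inv : ∀ σ, ρb σ * ρb σ⁻¹ = 1 := fun σ ↦ by
    rw [← hρb_mul, mul_inv_cancel, hρb_one]
  have hχ2_mul : ∀ σ τ, χ2 (σ * τ) = χ2 σ * χ2 τ := fun σ τ ↦ by
    simp only [hχ2]; rw [map_mul, Units.val_mul, map_mul]
  have hχ2_one : χ2 1 = 1 := by simp only [hχ2]; rw [map_one, Units.val_one, map_one]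
  have hχ2_inv_mul : ∀ σ, χ2 σ⁻¹ * χ2 σ = 1 := fun σ ↦ by
    rw [← hχ2_mul, inv_mul_cancel, hχ2_one]
  have hχ2_pow : ∀ σ (k : ℕ), χ2 (σ ^ k) = χ2 σ ^ k := fun σ k ↦ by
    induction k with
    | zero => rw [pow_zero, pow_zero, hχ2_one]
    | succ k ih => rw [pow_succ σ k, hχ2_mul, ih, pow_succ (χ2 σ) k]
  have hρb_pow : ∀ σ (k : ℕ), ρb (σ ^ k) = ρb σ ^ k := fun σ k ↦ by
    induction k with
    | zero => rw [pow_zero, pow_zero, hρb_one]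
    | succ k ih => rw [pow_succ σ k, hρb_mul, ih, pow_succ (ρb σ) k]
  -- `det [ρ σ] = χ σ`
  have hdetχ : ∀ σ, (LinearMap.toMatrix b b (ρ σ)).det = ((χ σ : ℤ_[p]ˣ) : ℤ_[p]) := fun σ ↦ by
    rw [LinearMap.det_toMatrix, hρ,
      det_galoisRepTate_eq_cyclotomicCharacter W p hp0 (fun n => exists_weilPairing_holds W _) σ]
  have hp2sq : ((p : ZMod (p ^ 2))) ^ 2 = 0 := by
    rw [← Nat.cast_pow, ZMod.natCast_self]
  -- (1) the kernel of `ρ̄` has `χ ≡ 1 (mod p²)` (this is where `hcon` is used)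
  have hker : ∀ σ, ρb σ = 1 → χ2 σ = 1 := by
    intro σ hσ
    obtain ⟨Y, hY⟩ := exists_eq_one_add_p_smul_of_mapMatrix_eq_one (p := p) hσ
    have hYfo : LinearMap.toMatrix b b (ρ σ) = 1 + (p : ℤ_[p]) • Y + ((p : ℤ_[p]) ^ 2) • 0 := by
      rw [hY, smul_zero, add_zero]
    have htr : ¬ IsUnit Y.trace := fun h ↦ hcon Y h σ 0 hYfo
    obtain ⟨y, hy⟩ := dvd_of_not_isUnit htr
    have hdet : (LinearMap.toMatrix b b (ρ σ)).det =
        1 + (p : ℤ_[p]) * Y.trace + (p : ℤ_[p]) ^ 2 * (Y 0 0 * Y 1 1 - Y 0 1 * Y 1 0) := by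
      rw [hY, Matrix.det_fin_two, Matrix.trace_fin_two]
      simp only [Matrix.add_apply, Matrix.one_apply_eq, Matrix.one_apply_ne (by decide : (0 : Fin 2) ≠ 1),
        Matrix.one_apply_ne (by decide : (1 : Fin 2) ≠ 0), Matrix.smul_apply, smul_eq_mul]
      ring
    rw [hdetχ, hy] at hdet
    simp only [hχ2]
    rw [hdet, map_add, map_add, map_one, map_mul, map_mul, map_mul, map_pow, map_natCast,
      ← mul_assoc, ← sq, hp2sq, zero_mul, zero_mul, add_zero, add_zero]
  -- (2) `χ2 σ ^ (2(p-1)) = 1` for every `σ`, by induction over transvections and diagonals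
  have hsurj : ∀ M : Matrix (Fin 2) (Fin 2) (ZMod p), M.det ≠ 0 → ∃ σ, ρb σ = M := fun M hM ↦
    exists_mapMatrix_toMatrix_galoisRepTate_eq h1 M hM
  have key : ∀ M : Matrix (Fin 2) (Fin 2) (ZMod p), M.det ≠ 0 →
      ∀ σ, ρb σ = M → χ2 σ ^ (2 * (p - 1)) = 1 := by
    intro M hM
    refine Matrix.diagonal_transvection_induction_of_det_ne_zero
      (fun N ↦ ∀ σ, ρb σ = N → χ2 σ ^ (2 * (p - 1)) = 1) M hM ?_ ?_ ?_
    · -- invertible diagonal matrices: `D^{p-1} = 1`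
      intro D hD σ hσ
      have hDi : ∀ i, D i ≠ 0 := by
        intro i hi
        apply hD
        rw [Matrix.det_diagonal]
        exact Finset.prod_eq_zero (Finset.mem_univ i) hi
      have hDp : ρb (σ ^ (p - 1)) = 1 := by
        rw [hρb_pow, hσ, Matrix.diagonal_pow]
        have : D ^ (p - 1) = fun _ ↦ 1 := funext fun i ↦ by
          rw [Pi.pow_apply]; exact ZMod.pow_card_sub_one_eq_one (hDi i)
        rw [this, Matrix.diagonal_one]
      have h := hker _ hDp
      rw [hχ2_pow] at h
      rw [mul_comm, pow_mul, h, one_pow]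
    · -- transvections: `T⁻² = T⁻¹ d T d⁻¹` is a commutator
      intro t σ hσ
      set d : Matrix (Fin 2) (Fin 2) (ZMod p) := !![(1 : ZMod p), 0; 0, -1] with hd
      have hd_det : d.det ≠ 0 := by
        rw [hd, Matrix.det_fin_two_of]; simp
      obtain ⟨δ, hδ⟩ := hsurj d hd_det
      have hdd : d * d = 1 := mat_diag_mul_diag
      have hδinv : ρb δ⁻¹ = d := by
        calc ρb δ⁻¹ = ρb δ⁻¹ * (d * d) := by rw [hdd, mul_one]
          _ = d := by rw [← mul_assoc, ← hδ, hρb_inv_mul, one_mul]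
      have hTT : t.toMatrix * t.inv.toMatrix = 1 := Matrix.TransvectionStruct.mul_inv t
      have hσinv : ρb σ⁻¹ = t.inv.toMatrix := by
        calc ρb σ⁻¹ = ρb σ⁻¹ * (t.toMatrix * t.inv.toMatrix) := by rw [hTT, mul_one]
          _ = t.inv.toMatrix := by rw [← mul_assoc, ← hσ, hρb_inv_mul, one_mul]
      have hcomm : ρb (σ * σ * (σ⁻¹ * δ * σ * δ⁻¹)) = 1 := by
        rw [hρb_mul, hρb_mul, hρb_mul, hρb_mul, hρb_mul, hσ, hσinv, hδ, hδinv,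
          mul_assoc t.inv.toMatrix d, mul_assoc t.inv.toMatrix, mat_diag_transvection_diag,
          mul_assoc t.toMatrix t.toMatrix, ← mul_assoc t.toMatrix t.inv.toMatrix, hTT, one_mul, hTT]
      have h := hker _ hcomm
      have hc1 : χ2 (σ⁻¹ * δ * σ * δ⁻¹) = 1 := by
        rw [hχ2_mul, hχ2_mul, hχ2_mul]
        calc χ2 σ⁻¹ * χ2 δ * χ2 σ * χ2 δ⁻¹ = (χ2 σ⁻¹ * χ2 σ) * (χ2 δ⁻¹ * χ2 δ) := by ring
          _ = 1 := by rw [hχ2_inv_mul, hχ2_inv_mul, mul_one]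
      rw [hχ2_mul, hc1, mul_one, hχ2_mul, ← sq] at h
      rw [pow_mul, h, one_pow]
    · -- products
      intro A B hA _ PA PB σ hσ
      obtain ⟨σA, hσA⟩ := hsurj A hA
      have hσB : ρb (σA⁻¹ * σ) = B := by
        rw [hρb_mul, hσ, ← mul_assoc, ← hσA, hρb_inv_mul, one_mul]
      have h := hχ2_mul σA (σA⁻¹ * σ)
      rw [mul_inv_cancel_left] at h
      rw [h, mul_pow, PA σA hσA, PB _ hσB, one_mul]
  -- (3) `σ₀` with `χ σ₀ = 1 + p` contradicts (2)
  have hirr : ∀ n : ℕ, 0 < n → Irreducible (Polynomial.cyclotomic n ℚ) :=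
    fun n hn => Polynomial.cyclotomic.irreducible_rat hn
  have hu : IsUnit (1 + (p : ℤ_[p]) * 1) := isUnit_one_add_p_mul 1
  obtain ⟨σ₀, hσ₀⟩ := GaloisRep.cyclotomicCharacter_surjective ℚ p hirr hu.unit
  have hχσ₀ : ((χ σ₀ : ℤ_[p]ˣ) : ℤ_[p]) = 1 + (p : ℤ_[p]) := by
    rw [hχ, hσ₀, IsUnit.unit_spec, mul_one]
  have hdet0 : (ρb σ₀).det ≠ 0 := by
    intro h0
    have h := congrArg Matrix.det (hρb_mul_inv σ₀)
    rw [Matrix.det_mul, h0, zero_mul, Matrix.det_one] at h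
    exact zero_ne_one h
  have h := key _ hdet0 σ₀ rfl
  simp only [hχ2] at h
  rw [hχσ₀, map_add, map_one, map_natCast, one_add_pow_of_sq_eq_zero hp2sq, add_eq_left,
    ← Nat.cast_mul, ZMod.natCast_eq_zero_iff] at h
  -- `p² ∣ 2(p-1)p` is absurd for `p` odd
  have h' : p ∣ 2 * (p - 1) := Nat.dvd_of_mul_dvd_mul_right hp.pos (by rwa [← pow_two])
  rcases (Nat.Prime.dvd_mul hp).mp h' with h2 | h3
  · exact hp2 ((Nat.prime_dvd_prime_iff_eq hp Nat.prime_two).mp h2)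
  · have : p ≤ p - 1 := Nat.le_of_dvd (by have := hp.two_le; omega) h3
    have := hp.two_le; omega

/-- **ONE first-order witness, non-scalar modulo `p`, gives the tower — NO trace hypothesis**
(`p` odd).  Let `E = W/ℚ` be an elliptic curve with `ρ̄_{E,p}` onto, `b` a `ℤ_p`-basis of `T_pE`,
and suppose some `τ ∈ Γ_ℚ` acts as `1 + p M₀ + p² V` with `M₀ mod p` NOT scalar (a unit among
`m₁₀, m₀₁, m₀₀ - m₁₁`).  Then `ρ̄_{E,p^n}` is onto for every `n` (`ρ_{E,p^∞}(Γ_ℚ) = GL₂(ℤ_p)`).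
Compared with `forall_hasSurjectiveModNGaloisRep_of_firstOrderWitness` the hypothesis
`tr M₀ ∈ ℤ_pˣ` is gone: a first-order element `S` with unit trace exists unconditionally
(`exists_firstOrder_isUnit_trace`: `det ρ = χ_p` is onto `ℤ_pˣ` and `GL₂(𝔽_p)` has no quotient
of order `p`); if `S` is scalar mod `p`, `S + M₀` is a witness with unit trace.  Group theory: the
image `G` of `ρ̄_{E,p²}` meets `1 + pM₂(𝔽_p)` in a `GL₂(𝔽_p)`-stable subgroup `V ∈ {0, 𝔽_p,
sl₂, M₂}`; a non-scalar element forces `V ⊇ sl₂`, and `V = sl₂` would make `G` the index-`p`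
subgroup `{det^{p-1} = 1}`... contradicting `det(G) = (ℤ/p²)ˣ`.  At `p = 3` this is the
certificate that replaces the false lifting "surj(3) ⟹ surj(9)" (Serre; Elkies 2006); it is what
the good-supersingular case of Wuthrich 2014 Lemma 20 consumes (inertia at `3` supplies a
non-scalar kernel element of unknown trace).
[cite: SerreAbelianLadic1968, Ch. IV §3.4, Lemma 3 (IV-23)] [cite: Elkies2006, Introduction (p. 1) and §1] -/
theorem forall_hasSurjectiveModNGaloisRep_of_firstOrderWitness_of_nonscalar [W.IsElliptic]
    (hp2 : p ≠ 2) (h1 : W.HasSurjectiveModNGaloisRep p)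
    (b : Module.Basis (Fin 2) ℤ_[p] (W.tateModule p)) (M₀ : Matrix (Fin 2) (Fin 2) ℤ_[p])
    (hM₀ : ∃ (τ : absoluteGaloisGroup ℚ) (V : Matrix (Fin 2) (Fin 2) ℤ_[p]),
      LinearMap.toMatrix b b (W.galoisRepTate p τ) = 1 + (p : ℤ_[p]) • M₀ + ((p : ℤ_[p]) ^ 2) • V)
    (hns : IsUnit (M₀ 1 0) ∨ IsUnit (M₀ 0 1) ∨ IsUnit (M₀ 0 0 - M₀ 1 1)) (n : ℕ) :
    W.HasSurjectiveModNGaloisRep (p ^ n : ℕ) := by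
  by_cases htr : IsUnit M₀.trace
  · exact forall_hasSurjectiveModNGaloisRep_of_firstOrderWitness hp2 h1 b M₀ hM₀ hns htr n
  obtain ⟨S, hStr, hS⟩ := exists_firstOrder_isUnit_trace hp2 h1 b
  by_cases hSns : IsUnit (S 1 0) ∨ IsUnit (S 0 1) ∨ IsUnit (S 0 0 - S 1 1)
  · exact forall_hasSurjectiveModNGaloisRep_of_firstOrderWitness hp2 h1 b S hS hSns hStr n
  push Not at hSns
  obtain ⟨h10, h01, hdd⟩ := hSns
  have hN := firstOrder_add hS hM₀
  refine forall_hasSurjectiveModNGaloisRep_of_firstOrderWitness hp2 h1 b (S + M₀) hN ?_ ?_ n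
  · rcases hns with h | h | h
    · left
      rw [Matrix.add_apply, add_comm]
      exact isUnit_add_of_dvd h (dvd_of_not_isUnit h10)
    · right; left
      rw [Matrix.add_apply, add_comm]
      exact isUnit_add_of_dvd h (dvd_of_not_isUnit h01)
    · right; right
      have : (S + M₀) 0 0 - (S + M₀) 1 1 = (M₀ 0 0 - M₀ 1 1) + (S 0 0 - S 1 1) := by
        simp only [Matrix.add_apply]; ring
      rw [this]
      exact isUnit_add_of_dvd h (dvd_of_not_isUnit hdd)
  · rw [Matrix.trace_add]
    exact isUnit_add_of_dvd hStr (dvd_of_not_isUnit htr)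

end FirstOrderNoTrace

end WeierstrassCurve

namespace Literature.NumberTheory.EllipticCurves

namespace Kato2004

open WeierstrassCurve Literature.NumberTheory.GaloisRepresentations

/-- **Kato's (12.5.2) from ONE non-scalar first-order witness** (`p` odd, no trace hypothesis):
surjectivity of `ρ̄_{E,p}` and a `τ ∈ Γ_ℚ` acting on `T_pE` as `1 + p M₀ + p² V` with `M₀ mod p`
non-scalar give (12.5.2) for `T_pE`. [cite: Kato2004Asterisque, (12.5.2) in Thm. 12.5 (4) (p. 222)]
[cite: SerreAbelianLadic1968, Ch. IV §3.4, Lemma 3 (IV-23)] -/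
theorem imageContainsSL2_of_firstOrderWitness_of_nonscalar (W : WeierstrassCurve ℚ) [W.IsElliptic]
    (p : ℕ) [Fact p.Prime] (hp2 : p ≠ 2) (h1 : W.HasSurjectiveModNGaloisRep p)
    (b : Module.Basis (Fin 2) ℤ_[p] (W.tateModule p)) (M₀ : Matrix (Fin 2) (Fin 2) ℤ_[p])
    (hM₀ : ∃ (τ : absoluteGaloisGroup ℚ) (V : Matrix (Fin 2) (Fin 2) ℤ_[p]),
      LinearMap.toMatrix b b (W.galoisRepTate p τ) = 1 + (p : ℤ_[p]) • M₀ + ((p : ℤ_[p]) ^ 2) • V)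
    (hns : IsUnit (M₀ 1 0) ∨ IsUnit (M₀ 0 1) ∨ IsUnit (M₀ 0 0 - M₀ 1 1)) :
    ImageContainsSL2 W p :=
  imageContainsSL2_of_forall_hasSurjectiveModNGaloisRep W p
    (forall_hasSurjectiveModNGaloisRep_of_firstOrderWitness_of_nonscalar hp2 h1 b M₀ hM₀ hns)

end Kato2004

end Literature.NumberTheory.EllipticCurves

end
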